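import Summits.BirchSwinnertonDyer.BirchSwinnertonDyer.Theorems.ByReductionTypeAtTwoRankOneSigmaHeightLevelOneLawUnconditional
import HarnessLib

/-!
# Route `ByReductionTypeAtTwo`, crux `RankOneAtTwoBigImageOddLocal` (item stmt-BirchSwinnertonDyer-23715), line AN62, σ₀-LEMMA BLOCK
# (cell `bsd-f1-sign2`, planner seat `-an` g50; `--supports 23715`, helper):
# **NON-VANISHING CRITERIA FOR THE σ-FORM 2-ADIC HEIGHT FROM THE LEVEL-ONE LAW: `D(P,P) ≠ 0` as soon as some multiple `mP = Q` has
# `‖x(Q)‖₂ = 4`, non-singular reduction everywhere, and either `a₂` is odd or `log₂ num x(Q) ≢ 8a₄ (mod 32)`**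

HONEST FRAMING (D-0036/D-0054): THEOREMS ONLY (no definition, no named fact, no `sorry`, no instance).  Binders as in
`…SigmaHeightLevelOneLawUnconditional`: `V/ℚ` `ℤ`-integral, `a₁ = 0`, `Sq = T² + O(T⁴)` a solution of the `σ²`-ODE at `c = 0`, `D : PAdicHeightData V 2`
ANY datum of σ-form on the local-conditions locus (`hD`).  The level-one law `D(Q,Q) ≡ log₂ num x(Q) − 8a₄ (mod 32)` gives `D(Q,Q) ≠ 0` whenever
`‖log₂ num x(Q) − 8a₄‖₂ > 1/32` (`pairing_ne_zero_of_lt_norm_sub`) and whenever `a₂` is odd (`pairing_ne_zero_of_norm_eq_four`, previous file);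
bilinearity `D(mP, mP) = m²D(P,P)` (`pairing_nsmul_nsmul`) transports this to ANY point `P` a multiple of which is such a `Q`
(`pairing_self_ne_zero_of_nsmul_eq_of_odd`, `pairing_self_ne_zero_of_nsmul_eq_of_lt_norm_sub`).  These are decidable, purely 2-adic/congruence
criteria for the non-vanishing of a 2-adic height pairing on a rational point (the cell's «signed object at 2» question, MEMO-an §54); they say
nothing about `BSDp`, the canonical (Mazur–Tate / Bernardi) normalisation is not asserted to be of σ-form here beyond hypothesis `hD`, item 23715
stays OPEN, BSD is proved for no curve.

References: [cite: MazurSteinTate2006, §1, §2.6] [cite: SilvermanAEC2009, III.2.3(d), VII.2].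
-/

set_option autoImplicit false

noncomputable section

open scoped Classical

open WeierstrassCurve PowerSeries Literature Literature.NumberTheory.EllipticCurves

namespace Summit.BirchSwinnertonDyer.BirchSwinnertonDyer.Theorems

namespace NaiveSigmaLogAtTwo

/-- Bilinearity: `D(mP, mP) = m²·D(P, P)`. [folklore] -/
theorem pairing_nsmul_nsmul {V : WeierstrassCurve ℚ} {p : ℕ} [Fact p.Prime] (D : PAdicHeightData V p) (m : ℕ)
    (P : V.toAffine.Point) : D.pairing (m • P) (m • P) = (m : ℚ_[p]) ^ 2 * D.pairing P P := by
  simp only [map_nsmul, AddMonoidHom.nsmul_apply, nsmul_eq_mul]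
  ring

/-- If `D(mP, mP) ≠ 0` then `D(P, P) ≠ 0`. [folklore] -/
theorem pairing_self_ne_zero_of_nsmul {V : WeierstrassCurve ℚ} {p : ℕ} [Fact p.Prime] (D : PAdicHeightData V p) (m : ℕ)
    (P : V.toAffine.Point) (hne : D.pairing (m • P) (m • P) ≠ 0) : D.pairing P P ≠ 0 := by
  intro h0
  apply hne
  rw [pairing_nsmul_nsmul, h0, mul_zero]

/-- **Non-vanishing at level one off one residue class**: if `‖log₂ num x(Q) − 8a₄‖₂ > 1/32` then `D(Q,Q) ≠ 0`.
[cite: MazurSteinTate2006, §1, §2.6] -/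
theorem pairing_ne_zero_of_lt_norm_sub (V : WeierstrassCurve ℚ) [V.IsIntegral ℤ] (ha1 : V.a₁ = 0)
    (Sq : ℚ_[2]⟦X⟧) (h0 : constantCoeff Sq = 0) (h1 : coeff 1 Sq = 0) (h2 : coeff 2 Sq = 1) (h3 : coeff 3 Sq = 0)
    (hODE : (V.baseChange ℚ_[2]).SatisfiesSigmaSqODE Sq 0) (D : PAdicHeightData V 2)
    (hD : ∀ {x y : ℚ} (h : V.toAffine.Nonsingular x y), V.SatisfiesLocalConditions 2 (.some x y h) →
      D.pairing (.some x y h) (.some x y h) = padicLog 2 ((x.den : ℚ) : ℚ_[2]) - padicLog 2 (padicEval Sq (-(x : ℚ_[2]) / y)))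
    {x y : ℚ} (h : V.toAffine.Nonsingular x y) (hx : ‖(x : ℚ_[2])‖ = 4)
    (hns : ∀ ℓ : ℕ, ℓ.Prime → V.HasNonsingularReductionAt ℓ x y)
    (hgt : 32⁻¹ < ‖padicLog 2 (x.num : ℚ_[2]) - 8 * (V.a₄ : ℚ_[2])‖) :
    D.pairing (.some x y h) (.some x y h) ≠ 0 := by
  intro h0'
  have hB := norm_pairing_sub_padicLog_num_add_le_of_norm_eq_four V ha1 Sq h0 h1 h2 h3 hODE D hD h hx hns
  rw [h0', show (0 : ℚ_[2]) - padicLog 2 (x.num : ℚ_[2]) + 8 * (V.a₄ : ℚ_[2])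
      = -(padicLog 2 (x.num : ℚ_[2]) - 8 * (V.a₄ : ℚ_[2])) by ring, norm_neg] at hB
  linarith

/-- **Non-vanishing transported down a multiple, odd `a₂`**: if `mP = Q = (x, y)` with `‖x‖₂ = 4`, non-singular reduction everywhere and
`a₂` odd, then `D(P,P) ≠ 0`. [cite: MazurSteinTate2006, §1, §2.6] -/
theorem pairing_self_ne_zero_of_nsmul_eq_of_odd (V : WeierstrassCurve ℚ) [V.IsIntegral ℤ] (ha1 : V.a₁ = 0)
    (Sq : ℚ_[2]⟦X⟧) (h0 : constantCoeff Sq = 0) (h1 : coeff 1 Sq = 0) (h2 : coeff 2 Sq = 1) (h3 : coeff 3 Sq = 0)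
    (hODE : (V.baseChange ℚ_[2]).SatisfiesSigmaSqODE Sq 0) (D : PAdicHeightData V 2)
    (hD : ∀ {x y : ℚ} (h : V.toAffine.Nonsingular x y), V.SatisfiesLocalConditions 2 (.some x y h) →
      D.pairing (.some x y h) (.some x y h) = padicLog 2 ((x.den : ℚ) : ℚ_[2]) - padicLog 2 (padicEval Sq (-(x : ℚ_[2]) / y)))
    (P : V.toAffine.Point) (m : ℕ) {x y : ℚ} (h : V.toAffine.Nonsingular x y) (hm : m • P = .some x y h)
    (hx : ‖(x : ℚ_[2])‖ = 4) (hns : ∀ ℓ : ℕ, ℓ.Prime → V.HasNonsingularReductionAt ℓ x y)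
    (a2 : ℤ) (ha2 : V.a₂ = a2) (hodd : Odd a2) :
    D.pairing P P ≠ 0 := by
  refine pairing_self_ne_zero_of_nsmul D m P ?_
  rw [hm]
  exact pairing_ne_zero_of_norm_eq_four V ha1 Sq h0 h1 h2 h3 hODE D hD h hx hns a2 ha2 hodd

/-- **Non-vanishing transported down a multiple, off one residue class**: if `mP = Q = (x, y)` with `‖x‖₂ = 4`, non-singular reduction
everywhere and `‖log₂ num x − 8a₄‖₂ > 1/32`, then `D(P,P) ≠ 0`. [cite: MazurSteinTate2006, §1, §2.6] -/
theorem pairing_self_ne_zero_of_nsmul_eq_of_lt_norm_sub (V : WeierstrassCurve ℚ) [V.IsIntegral ℤ] (ha1 : V.a₁ = 0)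
    (Sq : ℚ_[2]⟦X⟧) (h0 : constantCoeff Sq = 0) (h1 : coeff 1 Sq = 0) (h2 : coeff 2 Sq = 1) (h3 : coeff 3 Sq = 0)
    (hODE : (V.baseChange ℚ_[2]).SatisfiesSigmaSqODE Sq 0) (D : PAdicHeightData V 2)
    (hD : ∀ {x y : ℚ} (h : V.toAffine.Nonsingular x y), V.SatisfiesLocalConditions 2 (.some x y h) →
      D.pairing (.some x y h) (.some x y h) = padicLog 2 ((x.den : ℚ) : ℚ_[2]) - padicLog 2 (padicEval Sq (-(x : ℚ_[2]) / y)))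
    (P : V.toAffine.Point) (m : ℕ) {x y : ℚ} (h : V.toAffine.Nonsingular x y) (hm : m • P = .some x y h)
    (hx : ‖(x : ℚ_[2])‖ = 4) (hns : ∀ ℓ : ℕ, ℓ.Prime → V.HasNonsingularReductionAt ℓ x y)
    (hgt : 32⁻¹ < ‖padicLog 2 (x.num : ℚ_[2]) - 8 * (V.a₄ : ℚ_[2])‖) :
    D.pairing P P ≠ 0 := by
  refine pairing_self_ne_zero_of_nsmul D m P ?_
  rw [hm]
  exact pairing_ne_zero_of_lt_norm_sub V ha1 Sq h0 h1 h2 h3 hODE D hD h hx hns hgt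

/-- **In particular such a `P` has infinite order** (the pairing kills torsion). [folklore] -/
theorem not_isOfFinAddOrder_of_pairing_self_ne_zero {V : WeierstrassCurve ℚ} {p : ℕ} [Fact p.Prime] (D : PAdicHeightData V p)
    (P : V.toAffine.Point) (hne : D.pairing P P ≠ 0) : ¬ IsOfFinAddOrder P :=
  fun hP => hne (D.map_torsion P P hP)

end NaiveSigmaLogAtTwo

end Summit.BirchSwinnertonDyer.BirchSwinnertonDyer.Theorems
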